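import Literature.NumberTheory.Transcendental.GaGmSubgroupDegrees
import Mathlib.Data.Set.Card.Arithmetic
import HarnessLib

/-!
# Points, coordinate slices and cosets in `G = 𝔾ₐ × 𝔾ₘⁿ` (towards the degree of a subtorus)

Topic `Literature/NumberTheory/Transcendental`. Elementary complements to the Zariski toolkit
`GaGmZariski.lean` / `GaGmSubgroups.lean` of the tree's proof of Philippon's zero estimate on
`G = 𝔾ₐ × 𝔾ₘⁿ ⊂ (ℙ¹)ⁿ⁺¹`, needed for the general-rank lower bound of the multiplicity
`mult_{D₀,D₁}(V × T_A)` of a connected algebraic subgroup (the obstruction degree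
`𝓗(G*; D)` of Nesterenko 2003, Prop. 5.1 / Philippon 1986, §3, computed by induction on the
dimension through hypersurface sections). Everything here is PROVED; no named facts.

* Points: `{p}` is closed of dimension `0` (`isClosedG_singleton`, `dimG_singleton`); an
  irreducible closed set of dimension `0` is a point (`IsIrred.subsingleton_of_dimG_eq_zero`) and
  one of positive dimension is infinite (`IsIrred.infinite_of_dimG_pos`).
* Iterated sections: an irreducible closed `C ∋ p` cut by `m` hypersurfaces through `p` contains
  an irreducible closed `C' ∋ p` with `dim C ≤ dim C' + m` (`IsIrred.exists_irred_subset_zeroSet`).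
* Coordinate slices `{x = 0, y_j = 1 (j ∈ J)}` (a subgroup, `exists_subgroup_coe_eq_slice`); the
  slice count `#(H ∩ {x = 0, y_J = 1})` of a closed subgroup is at most the number of cosets of its identity
  component times the slice count of the identity component (`ncard_inter_slice_le`); degenerate slices are infinite
  (`ncard_inter_slice_eq_zero`).
* Characters: if the coordinate character `y_h` is non-trivial on an irreducible closed subgroup
  `H` (i.e. `e_h ∉ charGroup H`), its image is infinite (`infinite_image_coord`, by saturation of
  `charGroup H`).

## References

* P. Philippon, *Lemmes de zéros dans les groupes algébriques commutatifs*, Bull. Soc. Math.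
  France 114 (1986), 355–383, §3. [Philippon1986]
* Yu. V. Nesterenko, *Linear forms in logarithms of rational numbers*, LNM 1819 (2003), §5.1,
  (5.7). [Nesterenko2003]
-/

noncomputable section

open MvPolynomial Module
open scoped Pointwise

namespace Literature.NumberTheory.Transcendental

namespace GaGm

variable {n : ℕ}

/-! ### Points -/

/-- The affine coordinates determine the point. [cite: Hartshorne1977, Ch. I, §1 (affine coordinates)] -/
theorem coord_injective : Function.Injective (coord (m := n)) := by
  intro g g' h
  refine Prod.ext ?_ (funext fun j => Units.ext ?_)
  · have h0 := congrFun h 0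
    simp only [coord_zero] at h0
    exact Multiplicative.toAdd.injective h0
  · have hj := congrFun h j.succ
    simpa only [coord_succ] using hj

/-- The vanishing ideal of a point is the (maximal) ideal of affine polynomials vanishing at its
coordinates. [cite: Hartshorne1977, Ch. I, Cor. 1.4] -/
theorem vanishing_singleton (p : GaGm n) :
    vanishing ({p} : Set (GaGm n)) = MvPolynomial.vanishingIdeal ℂ {coord p} := by
  ext P
  rw [mem_vanishing_iff, MvPolynomial.mem_vanishingIdeal_singleton_iff]
  simp only [Set.mem_singleton_iff, forall_eq, evalAt_eq_eval]
  rfl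

/-- Points are closed. [cite: Hartshorne1977, Ch. I, Cor. 1.4] -/
theorem isClosedG_singleton (p : GaGm n) : IsClosedG ({p} : Set (GaGm n)) := by
  refine Set.Subset.antisymm (fun g hg => ?_) (subset_zeroSet_vanishing _)
  rw [Set.mem_singleton_iff]
  apply coord_injective
  funext i
  have hmem : X i - C (coord p i) ∈ vanishing ({p} : Set (GaGm n)) := by
    intro q hq
    rw [Set.mem_singleton_iff.mp hq, evalAt_eq_eval, map_sub, eval_X, eval_C, sub_self]
  have h := hg _ hmem
  rw [evalAt_eq_eval, map_sub, eval_X, eval_C, sub_eq_zero] at h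
  exact h

/-- Points have dimension `0`. [cite: Hartshorne1977, Ch. I, Prop. 1.7] -/
theorem dimG_singleton (p : GaGm n) : dimG ({p} : Set (GaGm n)) = 0 := by
  have h := dimG_eq (n := n) (Set.singleton_nonempty p)
  rw [vanishing_singleton] at h
  letI : Field (MvPolynomial (Fin (n + 1)) ℂ ⧸ MvPolynomial.vanishingIdeal ℂ {coord p}) :=
    Ideal.Quotient.field _
  rw [ringKrullDim_eq_zero_of_field] at h
  exact_mod_cast h

/-- An irreducible closed set of dimension `0` is a single point. [cite: Hartshorne1977, Ch. I, Prop. 1.10] -/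
theorem IsIrred.subsingleton_of_dimG_eq_zero {C : Set (GaGm n)} (hC : IsIrred C) (h : dimG C = 0) :
    C.Subsingleton := by
  intro p hp q hq
  by_contra hne
  have hss : ({p} : Set (GaGm n)) ⊂ C := by
    refine Set.ssubset_iff_subset_ne.mpr ⟨Set.singleton_subset_iff.mpr hp, fun heq => hne ?_⟩
    have : q ∈ ({p} : Set (GaGm n)) := by rw [heq]; exact hq
    exact (Set.mem_singleton_iff.mp this).symm
  have hlt := dimG_lt_of_ssubset hC (isClosedG_singleton p) (Set.singleton_nonempty p) hss
  omega

/-- An irreducible closed set of positive dimension is infinite. [cite: Hartshorne1977, Ch. I, Prop. 1.10] -/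
theorem IsIrred.infinite_of_dimG_pos {C : Set (GaGm n)} (hC : IsIrred C) (h : 1 ≤ dimG C) :
    C.Infinite := by
  intro hfin
  obtain ⟨p, hp, hsub⟩ := hC.exists_subset_of_subset_biUnion hfin.toFinset (fun p => ({p} : Set (GaGm n)))
    (fun p _ => isClosedG_singleton p) (fun x hx => Set.mem_biUnion (hfin.mem_toFinset.mpr hx) rfl)
  have hCp : C = {p} := Set.Subset.antisymm hsub (Set.singleton_subset_iff.mpr (hfin.mem_toFinset.mp hp))
  rw [hCp, dimG_singleton] at h
  omega

/-! ### Iterated hypersurface sections through a point -/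

/-- **Iterated sections.** If `p ∈ C`, `C` irreducible closed, and the finitely many polynomials of
`L` vanish at `p`, then `C ∩ Z(L)` contains an irreducible closed `C' ∋ p` with
`dim C ≤ dim C' + #L` (Krull's principal ideal theorem, one hypersurface at a time). [cite: Hartshorne1977, Ch. I, Prop. 1.13; Matsumura1987, Thm. 13.5] -/
theorem IsIrred.exists_irred_subset_zeroSet {C : Set (GaGm n)} (hC : IsIrred C) {p : GaGm n} (hp : p ∈ C)
    (L : Finset (MvPolynomial (Fin (n + 1)) ℂ)) (hL : ∀ ℓ ∈ L, evalAt ℓ p = 0) :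
    ∃ C' : Set (GaGm n), IsIrred C' ∧ p ∈ C' ∧ C' ⊆ C ∩ zeroSet (↑L : Set (MvPolynomial (Fin (n + 1)) ℂ)) ∧
      dimG C ≤ dimG C' + L.card := by
  classical
  induction L using Finset.induction_on with
  | empty =>
    refine ⟨C, hC, hp, fun g hg => ⟨hg, fun P hP => ?_⟩, by simp⟩
    simp at hP
  | insert ℓ L hℓ ih =>
    obtain ⟨C', hC', hpC', hsub, hdim⟩ := ih (fun ℓ' hℓ' => hL ℓ' (Finset.mem_insert_of_mem hℓ'))
    have hℓp : evalAt ℓ p = 0 := hL ℓ (Finset.mem_insert_self ℓ L)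
    rw [Finset.card_insert_of_notMem hℓ]
    by_cases hvan : ℓ ∈ vanishing C'
    · -- `C' ⊆ Z(ℓ)` already
      refine ⟨C', hC', hpC', fun g hg => ⟨(hsub hg).1, fun P hP => ?_⟩, by omega⟩
      rw [Finset.coe_insert, Set.mem_insert_iff] at hP
      rcases hP with rfl | hP
      · exact hvan g hg
      · exact (hsub hg).2 P hP
    · -- a component of `C' ∩ Z(ℓ)` through `p`
      have hpX : p ∈ C' ∩ zeroSet {ℓ} := ⟨hpC', fun P hP => by rw [Set.mem_singleton_iff.mp hP]; exact hℓp⟩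
      have hXcl : IsClosedG (C' ∩ zeroSet {ℓ}) := hC'.isClosedG.inter (isClosedG_zeroSet _)
      have hpX' := hpX
      rw [hXcl.eq_biUnion_minimalPrimes, Set.mem_iUnion₂] at hpX'
      obtain ⟨𝔮, h𝔮, hp𝔮⟩ := hpX'
      rw [Set.Finite.mem_toFinset] at h𝔮
      obtain ⟨hirr, -, hsub𝔮⟩ := isIrred_zeroSet_of_mem_minimalPrimes h𝔮
      rw [hXcl.eq] at hsub𝔮
      have hd := dimG_add_one_of_mem_minimalPrimes_section hC' hvan h𝔮
      refine ⟨zeroSet ↑𝔮, hirr, hp𝔮, fun g hg => ?_, by omega⟩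
      obtain ⟨hgC', hgℓ⟩ := hsub𝔮 hg
      refine ⟨(hsub hgC').1, fun P hP => ?_⟩
      rw [Finset.coe_insert, Set.mem_insert_iff] at hP
      rcases hP with rfl | hP
      · exact hgℓ P rfl
      · exact (hsub hgC').2 P hP

/-! ### Coordinate slices of subgroups -/

/-- The slice `{x = 0, y_j = 1 (j ∈ J)}` of `G(ℂ)` cut out by the additive coordinate and the torus
coordinates indexed by `J` is (the carrier of) a subgroup. [cite: Borel1991, §8.5] -/
theorem exists_subgroup_coe_eq_slice (J : Finset (Fin n)) :
    ∃ L : Subgroup (GaGm n), (L : Set (GaGm n)) = {g : GaGm n | g.1 = 1 ∧ ∀ j ∈ J, g.2 j = 1} :=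
  ⟨{ carrier := {g | g.1 = 1 ∧ ∀ j ∈ J, g.2 j = 1}
     one_mem' := by simp
     mul_mem' := by
       intro g g' hg hg'
       exact ⟨by rw [Prod.fst_mul, hg.1, hg'.1, one_mul],
         fun j hj => by rw [Prod.snd_mul, Pi.mul_apply, hg.2 j hj, hg'.2 j hj, one_mul]⟩
     inv_mem' := by
       intro g hg
       exact ⟨by rw [Prod.fst_inv, hg.1, inv_one],
         fun j hj => by rw [Prod.snd_inv, Pi.inv_apply, hg.2 j hj, inv_one]⟩ }, rfl⟩

/-- A coset `g·K` meets a subgroup `L` in the empty set or in a translate of `K ∩ L`; in either case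
`#(g·K ∩ L) ≤ #(K ∩ L)` (with `#` = `Set.ncard`, `0` for infinite sets). [cite: Borel1991, §8.5] -/
theorem ncard_smul_inter_le (K L : Subgroup (GaGm n)) (g : GaGm n) :
    (g • (K : Set (GaGm n)) ∩ (L : Set (GaGm n))).ncard ≤ ((K : Set (GaGm n)) ∩ (L : Set (GaGm n))).ncard := by
  by_cases hne : (g • (K : Set (GaGm n)) ∩ (L : Set (GaGm n))).Nonempty
  · obtain ⟨y, ⟨k, hk, rfl⟩, hyL⟩ := hne
    -- `g·K ∩ L = y·(K ∩ L)` with `y = g k`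
    have heq : g • (K : Set (GaGm n)) ∩ (L : Set (GaGm n)) =
        (g • k : GaGm n) • ((K : Set (GaGm n)) ∩ (L : Set (GaGm n))) := by
      ext z
      simp only [Set.mem_inter_iff, Set.mem_smul_set, smul_eq_mul, SetLike.mem_coe]
      constructor
      · rintro ⟨⟨k', hk', rfl⟩, hzL⟩
        refine ⟨k⁻¹ * k', ⟨K.mul_mem (K.inv_mem hk) hk', ?_⟩, by group⟩
        have : k⁻¹ * k' = (g * k)⁻¹ * (g * k') := by group
        rw [this]
        exact L.mul_mem (L.inv_mem hyL) hzL
      · rintro ⟨w, ⟨hwK, hwL⟩, rfl⟩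
        exact ⟨⟨k * w, K.mul_mem hk hwK, by group⟩, L.mul_mem hyL hwL⟩
    rw [heq, Set.ncard_smul_set]
  · rw [Set.not_nonempty_iff_eq_empty.mp hne, Set.ncard_empty]
    exact Nat.zero_le _

/-- **Slices and cosets.** If the closed subgroup `K` is covered by the finite family `𝒴` of cosets
of a subgroup `K₀`, then `#(K ∩ {x = 0, y_J = 1}) ≤ #𝒴 · #(K₀ ∩ {x = 0, y_J = 1})`. [cite: NesterenkoPhilippon2001, Ch. 11, §4] -/
theorem ncard_inter_slice_le (K K₀ : Subgroup (GaGm n)) (𝒴 : Finset (Set (GaGm n)))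
    (h𝒴 : ∀ Y ∈ 𝒴, ∃ f : GaGm n, Y = f • (K₀ : Set (GaGm n)))
    (hcov : (K : Set (GaGm n)) = ⋃ Y ∈ 𝒴, Y) (J : Finset (Fin n)) :
    ((K : Set (GaGm n)) ∩ {g : GaGm n | g.1 = 1 ∧ ∀ j ∈ J, g.2 j = 1}).ncard ≤
      𝒴.card * ((K₀ : Set (GaGm n)) ∩ {g : GaGm n | g.1 = 1 ∧ ∀ j ∈ J, g.2 j = 1}).ncard := by
  classical
  obtain ⟨L, hL⟩ := exists_subgroup_coe_eq_slice (n := n) J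
  rw [← hL]
  have heq : ((K : Set (GaGm n)) ∩ (L : Set (GaGm n))) = ⋃ Y ∈ 𝒴, (Y ∩ (L : Set (GaGm n))) := by
    rw [hcov, Set.iUnion₂_inter]
  calc ((K : Set (GaGm n)) ∩ (L : Set (GaGm n))).ncard
      = (⋃ Y ∈ 𝒴, (Y ∩ (L : Set (GaGm n)))).ncard := by rw [heq]
    _ ≤ ∑ Y ∈ 𝒴, (Y ∩ (L : Set (GaGm n))).ncard := Finset.set_ncard_biUnion_le _ _
    _ ≤ ∑ Y ∈ 𝒴, ((K₀ : Set (GaGm n)) ∩ (L : Set (GaGm n))).ncard := by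
        refine Finset.sum_le_sum fun Y hY => ?_
        obtain ⟨f, rfl⟩ := h𝒴 Y hY
        exact ncard_smul_inter_le K₀ L f
    _ = 𝒴.card * ((K₀ : Set (GaGm n)) ∩ (L : Set (GaGm n))).ncard := by
        rw [Finset.sum_const, smul_eq_mul]

/-- The cosets of the identity component of a closed subgroup, as a finite family of subsets
covering it. [cite: Borel1991, §1.2 Prop.] -/
theorem exists_cosets_idComp (K : Subgroup (GaGm n)) (hK : IsClosedG (K : Set (GaGm n))) :
    ∃ 𝒴 : Finset (Set (GaGm n)),
      (∀ Y ∈ 𝒴, ∃ f ∈ K, Y = f • ((idComp K hK : Subgroup (GaGm n)) : Set (GaGm n))) ∧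
      (K : Set (GaGm n)) = ⋃ Y ∈ 𝒴, Y := by
  classical
  obtain ⟨F, hFK, hcov⟩ := exists_finset_eq_biUnion_smul_idComp K hK
  refine ⟨F.image fun f => f • ((idComp K hK : Subgroup (GaGm n)) : Set (GaGm n)), ?_, ?_⟩
  · intro Y hY
    obtain ⟨f, hf, rfl⟩ := Finset.mem_image.mp hY
    exact ⟨f, hFK hf, rfl⟩
  · rw [hcov, Finset.set_biUnion_finset_image]

/-! ### Coordinate characters on an irreducible closed subgroup -/

/-- If the character `e_h` is trivial on `X`, the coordinate `y_h` is `1` on `X`. [cite: Borel1991, §8.5] -/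
theorem snd_eq_one_of_single_mem_charGroup {X : Set (GaGm n)} {h : Fin n}
    (hh : Pi.single h (1 : ℤ) ∈ charGroup X) {g : GaGm n} (hg : g ∈ X) : g.2 h = 1 := by
  have := (mem_charGroup_iff.mp hh) g hg
  rw [Finset.prod_eq_single h (fun j _ hj => by rw [Pi.single_eq_of_ne hj, zpow_zero])
    (fun h' => absurd (Finset.mem_univ h) h')] at this
  simpa using this

/-- **Non-trivial coordinate characters have infinite image.** If `e_h ∉ charGroup H` for an
irreducible closed subgroup `H`, then `y_h(H) ⊆ ℂˣ` is infinite (a finite image of order `m`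
would give `m·e_h ∈ charGroup H`, hence `e_h ∈ charGroup H` by saturation). [cite: Borel1991, §8.5 (characters of a connected diagonalizable group)] -/
theorem infinite_image_coord (H : Subgroup (GaGm n)) (hirr : IsIrred (H : Set (GaGm n))) (h : Fin n)
    (hh : Pi.single h (1 : ℤ) ∉ charGroup (H : Set (GaGm n))) :
    ((fun g : GaGm n => g.2 h) '' (H : Set (GaGm n))).Infinite := by
  intro hfin
  apply hh
  let φ : GaGm n →* ℂˣ := (Pi.evalMonoidHom (fun _ : Fin n => ℂˣ) h).comp (MonoidHom.snd _ _)
  have himg : ((H.map φ : Subgroup ℂˣ) : Set ℂˣ) = (fun g : GaGm n => g.2 h) '' (H : Set (GaGm n)) := by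
    ext u
    simp only [Subgroup.coe_map, Set.mem_image, SetLike.mem_coe]
    rfl
  haveI : Finite ↥(H.map φ) := by
    have : ((H.map φ : Subgroup ℂˣ) : Set ℂˣ).Finite := by rw [himg]; exact hfin
    exact this.to_subtype
  set m : ℕ := Nat.card ↥(H.map φ) with hm
  have hm0 : 0 < m := Nat.card_pos
  have hpow : ∀ g ∈ H, (g.2 h) ^ m = 1 := fun g hg => by
    have h1 : (⟨φ g, Subgroup.mem_map_of_mem φ hg⟩ : ↥(H.map φ)) ^ m = 1 := pow_card_eq_one'
    have h2 := congrArg Subtype.val h1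
    simpa [φ] using h2
  refine charGroup_saturated H hirr (k := (m : ℤ)) (by exact_mod_cast hm0.ne') ?_
  rw [mem_charGroup_iff]
  intro g hg
  rw [Finset.prod_eq_single h (fun j _ hj => by
      rw [Pi.smul_apply, Pi.single_eq_of_ne hj, smul_zero, zpow_zero])
    (fun h' => absurd (Finset.mem_univ h) h')]
  rw [Pi.smul_apply, Pi.single_eq_same, smul_eq_mul, mul_one, zpow_natCast]
  exact hpow g hg

/-- **Degenerate slices are infinite.** If `y_h ≡ 1` on the irreducible closed subgroup `H = V × T_A`
(`e_h ∈ A`) and `h ∈ J` with `#J = dim T_A`, then the slice `H ∩ {x = 0, y_J = 1}` is infinite, so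
its `Set.ncard` is `0` (it is cut out of `H` by at most `dim H - 1` hypersurfaces through `e`).
[cite: Nesterenko2003, §5.1 (5.7); Philippon1986, §3 Lemme 3.4] -/
theorem ncard_inter_slice_eq_zero (H : Subgroup (GaGm n)) (hirr : IsIrred (H : Set (GaGm n)))
    {J : Finset (Fin n)} (hJ : J.card = (toConnAlgSubgroup H hirr).torusDim) {h : Fin n} (hhJ : h ∈ J)
    (hh : Pi.single h (1 : ℤ) ∈ charGroup (H : Set (GaGm n))) :
    ((H : Set (GaGm n)) ∩ {g : GaGm n | g.1 = 1 ∧ ∀ j ∈ J, g.2 j = 1}).ncard = 0 := by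
  classical
  -- the cutting hypersurfaces
  set Lx : Finset (MvPolynomial (Fin (n + 1)) ℂ) :=
    if (toConnAlgSubgroup H hirr).addPart then {X 0} else ∅ with hLx
  set Ly : Finset (MvPolynomial (Fin (n + 1)) ℂ) := (J.erase h).image fun j => X j.succ - 1 with hLy
  have hLcard : (Lx ∪ Ly).card + 1 ≤ dimG (H : Set (GaGm n)) := by
    rw [dimG_eq_addDim_add_torusDim H hirr, ← hJ]
    have h1 : (Lx ∪ Ly).card ≤ Lx.card + Ly.card := Finset.card_union_le _ _
    have h2 : Ly.card ≤ (J.erase h).card := Finset.card_image_le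
    have h3 : (J.erase h).card + 1 = J.card := Finset.card_erase_add_one hhJ
    have h4 : Lx.card ≤ (toConnAlgSubgroup H hirr).addDim := by
      rw [hLx, ConnAlgSubgroup.addDim]
      split_ifs <;> simp
    omega
  have hvan : ∀ ℓ ∈ Lx ∪ Ly, evalAt ℓ (1 : GaGm n) = 0 := by
    intro ℓ hℓ
    rcases Finset.mem_union.mp hℓ with hℓ | hℓ
    · rw [hLx] at hℓ
      split_ifs at hℓ with hadd
      · rw [Finset.mem_singleton] at hℓ
        rw [hℓ, evalAt_eq_eval, eval_X, coord_zero]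
        rfl
      · simp at hℓ
    · rw [hLy, Finset.mem_image] at hℓ
      obtain ⟨j, -, rfl⟩ := hℓ
      rw [evalAt_eq_eval, map_sub, eval_X, map_one, coord_succ]
      simp
  obtain ⟨C', hC', h1C', hsub, hdim⟩ := hirr.exists_irred_subset_zeroSet H.one_mem (Lx ∪ Ly) hvan
  have hinf : C'.Infinite := hC'.infinite_of_dimG_pos (by omega)
  apply Set.Infinite.ncard
  refine hinf.mono fun g hg => ?_
  obtain ⟨hgH, hgZ⟩ := hsub hg
  refine ⟨hgH, ?_, fun j hj => ?_⟩
  · -- the additive coordinate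
    by_cases hadd : (toConnAlgSubgroup H hirr).addPart = true
    · have hX : (X 0 : MvPolynomial (Fin (n + 1)) ℂ) ∈ Lx ∪ Ly := by
        rw [hLx, if_pos hadd]; exact Finset.mem_union_left _ (Finset.mem_singleton_self _)
      have := hgZ _ (Finset.mem_coe.mpr hX)
      rw [evalAt_eq_eval, eval_X, coord_zero] at this
      exact Multiplicative.toAdd.injective (by simpa using this)
    · exact fst_eq_one_of_not_addPart H hirr (Bool.eq_false_iff.mpr hadd) hgH
  · by_cases hjh : j = h
    · rw [hjh]; exact snd_eq_one_of_single_mem_charGroup hh hgH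
    · have hX : (X j.succ - 1 : MvPolynomial (Fin (n + 1)) ℂ) ∈ Lx ∪ Ly := by
        rw [hLy]
        exact Finset.mem_union_right _ (Finset.mem_image.mpr ⟨j, Finset.mem_erase.mpr ⟨hjh, hj⟩, rfl⟩)
      have := hgZ _ (Finset.mem_coe.mpr hX)
      rw [evalAt_eq_eval, map_sub, eval_X, map_one, coord_succ, sub_eq_zero] at this
      exact Units.ext this

end GaGm

end Literature.NumberTheory.Transcendental
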